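import Summits.QuantumFields.QCD.Theses.EulerDescent
import Summits.QuantumFields.QCD.Theorems.RobustYangMillsHandover.Negative.SchemeAsymptotics

/-!
# Line `gap-upset-recut` for crux `SpectralDefectExtinction.ChiralDescent` (stmt-QuantumFields-17527) —
# stub Q2 `stub_gapUpsetNoStart` REDUCED to route EulerDescent's `RayDescent` (stmt-16900) and
# `ChiralCornerSoftness` (stmt-16902) plus ONE typed residual, `CornerPin` (lead a1, cycle 1; `--supports`)

The registered stub Q2 of `Cruxes/ChiralDescent/Lines/gap_upset_recut.lean` ("the uniform-gap up-set never starts at a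
body offset") says: for `N_f ∈ {2,3}`, an interior mass-scaling regularisation `reg`, an offset `μ` above which the
body holds, and ONE lattice rate `ε` on every tuple above `μ`, there is ONE lattice rate on every tuple above some
`μ' < μ`.  The skeleton certifies only its sub-case above a corner PINNED AT `0` (`uniformGapAbove_descend_of_rayDescent`,
for regularisations that themselves satisfy the hypotheses of `RayDescent`).  This file certifies the whole stub from
three inputs, the first two being OPEN ITEMS OF ANOTHER ROUTE taken as hypotheses (conditional theorem):

* `Theses.EulerDescent.RayDescent` (stmt-QuantumFields-16900): along a regularisation pinned at an eventual intrinsic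
  corner, the rate `Δ` at `l·m` gives every rate `< Δ/l` at `m` (positive tuples, `l ≥ 1`);
* `Theses.EulerDescent.ChiralCornerSoftness` (stmt-QuantumFields-16902): such a pinned regularisation is chiral at zero;
* `CornerPin` (NEW, typed here as the hypothesis `hPin`, not a registered statement): every interior mass-scaling
  regularisation carrying the body above some offset admits an eventual intrinsic corner `mc(k)` (the least upper bound
  of the non-massive degenerate bare masses at `β_k`, verbatim the corner of `RayDescent`) and a CONVERGENT renormalised
  offset `(m_crit(k) − mc(k))·Z_m(k)/a_k → μ₀ ∈ ℝ`.

Mechanism (`stub_gapUpsetNoStart_of_cornerPin`): re-zero `reg` at the corner, `reg₀.m_crit := m_crit − a μ₀/Z_m`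
(`reg₀.scheme m = reg.scheme (m − μ₀)`, `cornerShift_scheme_eq`); `reg₀` is pinned, keeps mass scaling and asymptotic
scaling (read off one body tuple) and is eventually on the physical branch (interiority + `a μ₀/Z_m → 0`).  If the
corner offset `−μ₀` is `≥ μ`, the one rate above `μ` is a rate at EVERY positive tuple of `reg₀`, against
`ChiralCornerSoftness` — so this case is empty and Q2 holds vacuously (this is the "PCAC-chiral body offset" case (χ)
of the line card, discharged by 16902 instead of the anomaly / Goldstone engines).  If `−μ₀ < μ`, `RayDescent` for `reg₀`
transports the rate from the offset `μ + μ₀ > 0` down to `(μ + μ₀)/2` (`rate_descend_of_rayProperty`, the ray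
bookkeeping of the skeleton), i.e. to the `reg`-offset `μ' = (μ − μ₀)/2 < μ` — case (w) of the card, discharged by 16900.
Hence, given 16900 ∧ 16902, the NEW content of Q2 is exactly `CornerPin` (corner existence + convergence of the
renormalised offset for body-carrying interior regularisations); information for the planner of 17527 / 16900–16903.
Honesty: 16900, 16902 and `CornerPin` are open-problem grade; nothing here proves physics.  In the Sharpe–Singleton
FIRST-ORDER scenario the non-massive set near the physical critical line is empty at fixed `β` and the intrinsic corner
of `RayDescent` sits elsewhere, so `CornerPin` (as typed by route EulerDescent's corner) may fail for an honest Wilson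
regularisation — the same caveat as items 16900–16902 themselves.  Pure bookkeeping over `QCDOS.lean`; standard axioms.
-/

namespace Summit.QuantumFields.QCD.Cruxes.ChiralDescent.GapUpsetRecut

open Filter Topology
open Literature.MathematicalPhysics.QuantumFieldTheory
open Summit.QuantumFields.QCD.Theorems.RobustYangMillsHandover.Negative (tendsto_massIncrement_zero)

variable {Nf : ℕ}

/-- **Ray property ⇒ the uniform-gap up-set descends above a corner pinned at `0`** (the ray bookkeeping of the
skeleton `Lines/gap_upset_recut.lean`, `uniformGapAbove_descend_of_rayProperty`, restated under a tree name): if for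
every positive tuple `m`, every `l ≥ 1` and every rate `Δ`, the rate `Δ` at `l·m` gives every rate `Δ' < Δ/l` at `m`,
then ONE rate above `μ > 0` gives ONE rate (`ε μ'/(2μ)`) above every `μ' ∈ (0, μ)`. [folklore] -/
theorem rate_descend_of_rayProperty (gap : (Fin Nf → ℝ) → ℝ → Prop)
    (hray : ∀ m : Fin Nf → ℝ, (∀ f, 0 < m f) → ∀ l : ℝ, 1 ≤ l → ∀ Δ : ℝ, 0 < Δ →
      gap (fun f => l * m f) Δ → ∀ Δ' : ℝ, 0 < Δ' → Δ' < Δ / l → gap m Δ')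
    {μ μ' : ℝ} (hμ' : 0 < μ') (hlt : μ' < μ)
    (hG : ∃ ε > (0 : ℝ), ∀ m : Fin Nf → ℝ, (∀ f, μ < m f) → gap m ε) :
    ∃ ε > (0 : ℝ), ∀ m : Fin Nf → ℝ, (∀ f, μ' < m f) → gap m ε := by
  obtain ⟨ε, hε, hg⟩ := hG
  have hμ : 0 < μ := lt_trans hμ' hlt
  have hl : 1 ≤ μ / μ' := (one_le_div hμ').mpr hlt.le
  have hlpos : 0 < μ / μ' := div_pos hμ hμ'
  refine ⟨ε * μ' / (2 * μ), by positivity, fun m hm => ?_⟩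
  have hmpos : ∀ f, 0 < m f := fun f => lt_trans hμ' (hm f)
  have hup : gap (fun f => μ / μ' * m f) ε := by
    refine hg _ fun f => ?_
    have h1 : μ / μ' * μ' = μ := div_mul_cancel₀ μ hμ'.ne'
    have h2 : μ / μ' * μ' < μ / μ' * m f := mul_lt_mul_of_pos_left (hm f) hlpos
    linarith
  refine hray m hmpos (μ / μ') hl ε hε hup _ (by positivity) ?_
  rw [lt_div_iff₀ hlpos]
  have h3 : ε * μ' / (2 * μ) * (μ / μ') = ε / 2 := by
    field_simp
  rw [h3]
  linarith

/-- **Re-zeroing at the corner.** The regularisation `reg₀` with `m_crit` lowered by `a_k μ₀ / Z_m(k)` runs at the tuple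
`m` the scheme of `reg` at `m − μ₀` (same `β, L, a`, same species renormalisations). [folklore] -/
theorem cornerShift_scheme_eq (reg : QCDRegularisation Nf) (μ₀ : ℝ) (m : Fin Nf → ℝ)
    (z shift : QCDField Nf → ℕ → ℝ) :
    ({ reg with mcrit := fun k => reg.mcrit k + reg.a k * (-μ₀) / reg.Zm k } : QCDRegularisation Nf).scheme m z shift
      = reg.scheme (fun f => m f - μ₀) z shift := by
  simp only [QCDRegularisation.scheme, QCDScheme.mk.injEq, true_and, and_true]
  funext f k
  ring

/-- **Q2 ⇐ `RayDescent` (16900) ∧ `ChiralCornerSoftness` (16902) ∧ `CornerPin`.**  For `N_f ∈ {2,3}`, an interior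
mass-scaling regularisation with the body above `μ` and ONE lattice rate above `μ`: IF the two EulerDescent items hold
and IF the regularisation admits an eventual intrinsic corner `mc` with a convergent renormalised offset
`(m_crit − mc)·Z_m/a → μ₀` (hypothesis `hPin`, stated for all such regularisations), THEN one lattice rate holds above
some `μ' < μ` — VERBATIM the conclusion (indeed the whole statement) of the registered stub `stub_gapUpsetNoStart`.
Case `−μ₀ ≥ μ`: the rate above `μ` is a rate at every positive tuple of the re-zeroed `reg₀`, contradicting
`reg₀.IsChiralAtZero` from 16902 (empty case).  Case `−μ₀ < μ`: 16900 for `reg₀` and `rate_descend_of_rayProperty`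
descend the rate to the `reg`-offset `(μ − μ₀)/2 < μ`. [folklore] -/
theorem stub_gapUpsetNoStart_of_cornerPin :
    ∀ (h16900 : Theses.EulerDescent.RayDescent) (h16902 : Theses.EulerDescent.ChiralCornerSoftness)
    (hPin : ∀ Nf : ℕ, (Nf = 2 ∨ Nf = 3) → ∀ reg : QCDRegularisation Nf, reg.HasMassScaling →
      (∃ c : ℝ, -1 < c ∧ ∀ᶠ k in atTop, c ≤ reg.mcrit k) → ∀ μ : ℝ,
      (∀ m : Fin Nf → ℝ, (∀ f, μ < m f) →
        ∃ (z shift : QCDField Nf → ℕ → ℝ) (T : OSData (QCDField Nf) 4),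
          IsQCDAlong (reg.scheme m z shift) T ∧ T.IsNontrivial QCDField.glue ∧ T.IsNonGaussian QCDField.glue ∧
            (∀ f g : Fin Nf, f ≠ g → T.IsNontrivial (QCDField.pseudoRe f g)) ∧
              ∃ Δ > 0, T.HasMassGap Δ ∧ (reg.scheme m z shift).HasLatticeMassGap Δ) →
      ∃ (mc : ℕ → ℝ) (μ₀ : ℝ),
        (∀ᶠ k in atTop, IsLUB {ν : ℝ | ¬ (∀ (R R' : ℕ) (A : QCDLatticeObservable Nf R)
          (B : QCDLatticeObservable Nf R'), ∃ (C δ : ℝ) (S₀ : ℕ), 0 < δ ∧ ∀ S : ℕ, S₀ ≤ S → ∀ n : ℕ, n ≤ S →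
            ‖qcdLatticeConnectedCorr (reg.β k) (2 * S + 1) (fun _ : Fin Nf => ν) A B n‖ ≤ C * Real.exp (-(δ * n)))}
          (mc k)) ∧
        Tendsto (fun k => (reg.mcrit k - mc k) * reg.Zm k / reg.a k) atTop (𝓝 μ₀)),
    ∀ Nf : ℕ, (Nf = 2 ∨ Nf = 3) → ∀ reg : QCDRegularisation Nf, reg.HasMassScaling →
    (∃ c : ℝ, -1 < c ∧ ∀ᶠ k in atTop, c ≤ reg.mcrit k) → ∀ μ : ℝ,
    (∀ m : Fin Nf → ℝ, (∀ f, μ < m f) →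
      ∃ (z shift : QCDField Nf → ℕ → ℝ) (T : OSData (QCDField Nf) 4),
        IsQCDAlong (reg.scheme m z shift) T ∧ T.IsNontrivial QCDField.glue ∧ T.IsNonGaussian QCDField.glue ∧
          (∀ f g : Fin Nf, f ≠ g → T.IsNontrivial (QCDField.pseudoRe f g)) ∧
            ∃ Δ > 0, T.HasMassGap Δ ∧ (reg.scheme m z shift).HasLatticeMassGap Δ) →
    (∃ ε > (0 : ℝ), ∀ m : Fin Nf → ℝ, (∀ f, μ < m f) → (reg.scheme m 0 0).HasLatticeMassGap ε) →
    ∃ μ' : ℝ, μ' < μ ∧ ∃ ε > (0 : ℝ), ∀ m : Fin Nf → ℝ, (∀ f, μ' < m f) → (reg.scheme m 0 0).HasLatticeMassGap ε := by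
  intro h16900 h16902 hPin Nf hNf reg hMS hint μ hbody hG
  have hNf16 : Nf ≤ 16 := by rcases hNf with rfl | rfl <;> norm_num
  obtain ⟨mc, μ₀, hcorner, hpin⟩ := hPin Nf hNf reg hMS hint μ hbody
  -- re-zero at the corner
  set reg₀ : QCDRegularisation Nf :=
    { reg with mcrit := fun k => reg.mcrit k + reg.a k * (-μ₀) / reg.Zm k } with hreg₀
  have hs : ∀ (m : Fin Nf → ℝ) (z shift : QCDField Nf → ℕ → ℝ),
      reg₀.scheme m z shift = reg.scheme (fun f => m f - μ₀) z shift :=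
    fun m z shift => cornerShift_scheme_eq reg μ₀ m z shift
  have hs' : ∀ (m : Fin Nf → ℝ), reg.scheme m 0 0 = reg₀.scheme (fun f => m f + μ₀) 0 0 := by
    intro m
    rw [hs]
    congr 1
    funext f
    ring
  have hMS₀ : reg₀.HasMassScaling := hMS
  -- asymptotic scaling, read off the body tuple μ + 1
  obtain ⟨z₁, s₁, T₁, hQ₁, -⟩ := hbody (fun _ => μ + 1) (fun _ => by linarith)
  have hAS₀ : (reg₀.scheme 0 0 0).HasAsymptoticScaling := by
    obtain ⟨hAS, -⟩ := hQ₁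
    exact hAS
  -- the corner and the pin of reg₀
  have hcorner₀ : ∀ᶠ k in atTop, IsLUB {ν : ℝ | ¬ (∀ (R R' : ℕ) (A : QCDLatticeObservable Nf R)
      (B : QCDLatticeObservable Nf R'), ∃ (C δ : ℝ) (S₀ : ℕ), 0 < δ ∧ ∀ S : ℕ, S₀ ≤ S → ∀ n : ℕ, n ≤ S →
        ‖qcdLatticeConnectedCorr (reg₀.β k) (2 * S + 1) (fun _ : Fin Nf => ν) A B n‖ ≤ C * Real.exp (-(δ * n)))}
      (mc k) := hcorner
  have hpin₀ : Tendsto (fun k => (reg₀.mcrit k - mc k) * reg₀.Zm k / reg₀.a k) atTop (𝓝 0) := by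
    have h1 : Tendsto (fun k => (reg.mcrit k - mc k) * reg.Zm k / reg.a k - μ₀) atTop (𝓝 (μ₀ - μ₀)) :=
      hpin.sub_const μ₀
    rw [sub_self] at h1
    refine h1.congr' (Eventually.of_forall fun k => ?_)
    have ha : reg.a k ≠ 0 := (reg.a_pos k).ne'
    have hZ : reg.Zm k ≠ 0 := (reg.Zm_pos k).ne'
    change (reg.mcrit k - mc k) * reg.Zm k / reg.a k - μ₀ =
      ((reg.mcrit k + reg.a k * (-μ₀) / reg.Zm k) - mc k) * reg.Zm k / reg.a k
    field_simp
    ring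
  -- the branch of reg₀: interiority plus a vanishing increment
  have hbranch₀ : ∀ᶠ k in atTop, (-1 : ℝ) < reg₀.mcrit k := by
    obtain ⟨c, hc, hev⟩ := hint
    have h0 := tendsto_massIncrement_zero hNf16 reg hMS (-μ₀)
    have hneg : -((c + 1) / 2) < (0 : ℝ) := by linarith
    filter_upwards [hev, (tendsto_order.mp h0).1 (-((c + 1) / 2)) hneg] with k hk hk'
    change (-1 : ℝ) < reg.mcrit k + reg.a k * (-μ₀) / reg.Zm k
    linarith
  -- the two EulerDescent items for reg₀
  have hray := h16900 Nf reg₀ mc hcorner₀ hpin₀ hMS₀ hAS₀ hbranch₀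
  have hsoft : reg₀.IsChiralAtZero := h16902 Nf hNf reg₀ mc hcorner₀ hpin₀ hMS₀ hAS₀ hbranch₀
  obtain ⟨ε, hε, hgap⟩ := hG
  by_cases hcase : μ + μ₀ ≤ 0
  · -- the corner offset −μ₀ is ≥ μ: the rate above μ gaps every positive tuple of reg₀ — against softness
    exfalso
    obtain ⟨m, hm, hno⟩ := hsoft ε hε
    refine hno ?_
    rw [hs]
    exact hgap _ fun f => by have := hm f; linarith
  · -- descend along rays from μ + μ₀ > 0 to (μ + μ₀)/2 in reg₀-coordinates
    push Not at hcase
    have hG₀ : ∃ ε > (0 : ℝ), ∀ m : Fin Nf → ℝ, (∀ f, μ + μ₀ < m f) → (reg₀.scheme m 0 0).HasLatticeMassGap ε := by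
      refine ⟨ε, hε, fun m hm => ?_⟩
      rw [hs]
      exact hgap _ fun f => by have := hm f; linarith
    have hhalf : (0 : ℝ) < (μ + μ₀) / 2 := by linarith
    have hlt : (μ + μ₀) / 2 < μ + μ₀ := by linarith
    obtain ⟨ε', hε', hgap'⟩ := rate_descend_of_rayProperty
      (fun m Δ => (reg₀.scheme m 0 0).HasLatticeMassGap Δ) hray hhalf hlt hG₀
    refine ⟨(μ - μ₀) / 2, by linarith, ε', hε', fun m hm => ?_⟩
    rw [hs']
    exact hgap' _ fun f => by have := hm f; linarith

end Summit.QuantumFields.QCD.Cruxes.ChiralDescent.GapUpsetRecut
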